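import Literature.NumberTheory.Automorphic.AsaiSign
import Literature.NumberTheory.Automorphic.BaseChangeInductionAlong

/-!
# The pane law — stub `stub_paneLaw` of line `one-transparent-pane`
(crux `Summit.Langlands.Langlands.Theses.QuadraticWindow.HostInducedRep`, item stmt-Langlands-10902)

LOG.  LEAD EDIT (2026-08-16 09:30Z): `hMok` replaced by the fact-free EXISTENCE hypothesis `hex` (∃ κ, HasAsaiSign c κ for
cuspidal conjugate self-dual `P`) — the drefuter's reshaped form (DrefuteStubPaneLaw.md); the theorem is now pure logic in the
textual form `theorem stub_paneLaw_cond : hex → hpin → htransfer → conclusion`.  Worker's original log follows.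
LOG (worker).  Proved: `stub_paneLaw_cond (hMok : Mok2014_partialAsaiL_pole_dichotomy) : <registered
signature verbatim>` — the registered signature is provable only modulo the EXISTING tree named fact
`Literature.NumberTheory.Automorphic.Mok2014_partialAsaiL_pole_dichotomy` (Mok 2014, Thm. 2.5.4 (a):
existence of the Asai sign of a conjugate self-dual cuspidal representation), exactly as the planner's
docstring says; no other hypothesis (the registered signature follows `hMok` VERBATIM, checked by
`diff` against lines 153–183 of the skeleton).  Why `hMok` cannot be dropped: the conclusion
`Q.1.HasAsaiSign cK 1` is a genuine (typed) pole of a partial Asai `L`-function, `hpin` only speaks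
about a `P` that already HAS an Asai sign, and `htransfer` only moves poles between `Q` and `P`; the
existence of a sign for `P` is exactly Mok's dichotomy (the standing adversary, Disproof §13, reaches
the same verdict: "dischargeable only modulo `Mok2014_partialAsaiL_pole_dichotomy` — thread it as a
hypothesis"; it also flags that fact as Ramanujan-strength AS TYPED for rank `≥ 3`, see the tree file
`Literature/NumberTheory/Automorphic/AsaiSignContinuation.lean`, whose proved reduction
`Mok2014_partialAsaiL_pole_dichotomy_of_continuation h hhol` lets the lead trade `hMok` for the
corrected pair `(h, hhol)` if preferred — `hMok` is the weaker hypothesis of the two).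
Checks: `lean check` rc 0, errors [], warnings [], sorries 0 (audit: `orphan` ×2 only, because the
theorem is named `stub_paneLaw_cond`, not the registered `stub_paneLaw`).
Dry-run verdict (`ledger propose --kind proof --target
Summits/Langlands/Langlands/Theorems/QuadraticWindowHostInducedRepPaneLaw.lean --file work/stubs/PaneLaw.lean
--supports stmt-Langlands-10902 --dry-run`, 2026-08-16): "DRY-RUN (nothing recorded) would-be verdict:
ACCEPT [stage route] codes=- … would be accepted after verify … note: disables a linter (lint debt)"
(the `set_option linter.dupNamespace false` below; without it the `dupNamespace` linter fires on the
mandated namespace `Summit.Langlands.Langlands.…`, 2 warnings, as in the landed sibling files).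
Not proposed for real: per the wave rules the lead reshapes the registered signature to take `hMok`
and lands this file by name (rename `stub_paneLaw_cond` → `stub_paneLaw`).

Setting.  A tower of number fields `F₀ ⊂ K ⊂ L`, `F' ⊂ L`, with `K/F₀` quadratic (involution `cK`),
`L/K` quadratic, `L/F'` quadratic (involution `s`) and `s|_K = cK`; `P` a cuspidal automorphic
representation of `GL_n(𝔸_L)` (`0 < n`), conjugate self-dual almost everywhere w.r.t. `s`; `Q` a cuspidal
automorphic representation of `GL_{2n}(𝔸_K)`, a weak automorphic induction of `P`, conjugate self-dual
w.r.t. `cK`.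

Statement (`stub_paneLaw`).  GIVEN the sign pin `hpin` (statement of the neighbour stub `stub_signPin`:
a conjugate self-dual cuspidal representation of Asai sign `κ` whose exponents at a `c`-fixed complex
place are multiplicity free and lie in one real coset `r + ℤ` has that coset equal to
`(N-1)/2 + (1-κ)/4 + ℤ`) and the Asai pole transfer `htransfer` (statement of the neighbour stub
`stub_asaiPoleInduced`: `Q.HasAsaiPole cK ε ↔ P.HasAsaiPole s ε` for both signs `ε`): if at an
`s`-fixed complex place `σ` of `L` the archimedean exponents `χ σ` of `P` are multiplicity free, `n` in
number, and all in `½ + ℤ`, then `Q` has the STANDARD Asai sign, `Q.HasAsaiSign cK 1`.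

Proof.
1. Mok's dichotomy (`Mok2014_partialAsaiL_pole_dichotomy`, through the proved consequence
   `CuspidalAutomorphicRepData.exists_hasAsaiSign`) gives a sign `κ` with `P.HasAsaiSign s κ`.
2. The pin with `r = ½`: every `a ∈ χ σ` is `m + (n-1)/2 + (1-κ)/4` with `m ∈ ℤ`; since
   `card (χ σ) = n > 0` there is such an `a`, also equal to `m' + ½`.  Clearing denominators,
   `κ = 4(m - m') + 2n - 3` in `ℤ` (injectivity of `ℤ → ℂ`), so `κ ≡ 2n + 1 (mod 4)`:
   `κ = 1` if `n` is even and `κ = -1` if `n` is odd (`κ ∈ {±1}`, `Int.units_eq_one_or`; `omega`).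
3. In either parity `P.HasAsaiSign s κ` is `P.HasAsaiPole s (-1)` (`hasAsaiSign_iff_of_even`:
   `HasAsaiSign s 1 ↔ HasAsaiPole s (-1)` for even `n`; `hasAsaiSign_iff_of_odd`:
   `HasAsaiSign s (-1) ↔ HasAsaiPole s (-1)` for odd `n`).
4. The transfer gives `Q.HasAsaiPole cK (-1)`, which for the even rank `2n` is `Q.HasAsaiSign cK 1`
   (`hasAsaiSign_iff_of_even`).

References: C. P. Mok, *Endoscopic classification of representations of quasi-split unitary groups*,
Mem. AMS 235 (2015), Thm. 2.5.4 (a) [Mok2014]; Y. Flicker, *Twisted tensors and Euler products*,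
Bull. SMF 116 (1988) [Flicker1988].
-/

set_option linter.dupNamespace false -- project-wide option (lakefile weak.linter.dupNamespace); `Summit.Langlands.Langlands` is the mandated namespace

open Literature.NumberTheory.Automorphic
open IsDedekindDomain NumberField Filter

namespace Summit.Langlands.Langlands.Theorems.HostInducedRep.OneTransparentPane

/-! ### Arithmetic of the pin at `r = ½` -/

/-- The parity computation of the pane law: if `m' + ½ = m + (n-1)/2 + (1-κ)/4` in `ℂ` with
`m, m' ∈ ℤ`, `n ∈ ℕ` and `κ ∈ ℤˣ = {±1}`, then `κ = 1` when `n` is even and `κ = -1` when `n` is odd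
(clearing denominators, `κ = 4(m - m') + 2n - 3 ≡ 2n + 1 (mod 4)`). [folklore] -/
theorem units_eq_of_half_eq_pin {m m' : ℤ} {n : ℕ} {κ : ℤˣ}
    (h : (m' : ℂ) + 1 / 2 = (m : ℂ) + ((n : ℂ) - 1) / 2 + (1 - ((κ : ℤ) : ℂ)) / 4) :
    (Even n → κ = 1) ∧ (Odd n → κ = -1) := by
  have key : (((κ : ℤ) : ℂ)) = ((4 * (m - m') + 2 * (n : ℤ) - 3 : ℤ) : ℂ) := by
    push_cast
    linear_combination 4 * h
  have hkz : (κ : ℤ) = 4 * (m - m') + 2 * (n : ℤ) - 3 := by exact_mod_cast key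
  rcases Int.units_eq_one_or κ with rfl | rfl
  · refine ⟨fun _ => rfl, fun hodd => ?_⟩
    exfalso
    obtain ⟨k, hk⟩ := hodd
    rw [Units.val_one] at hkz
    omega
  · refine ⟨fun hev => ?_, fun _ => rfl⟩
    exfalso
    obtain ⟨k, hk⟩ := hev
    rw [Units.val_neg, Units.val_one] at hkz
    omega

/-! ### The pane law (conditional on Mok's dichotomy) -/

/-- **The pane law** (stub `stub_paneLaw` of line `one-transparent-pane`, conditional on the tree's
named fact `Mok2014_partialAsaiL_pole_dichotomy`).  GIVEN the sign pin (statement of `stub_signPin`)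
and the Asai pole transfer in the biquadratic tower (statement of `stub_asaiPoleInduced`): if `P`
(cuspidal on `GL_n/L`, `s`-conjugate self-dual, `Q = AI_{L/K}(P)` cuspidal and `cK`-conjugate
self-dual) shows at an `s`-fixed complex place `σ` of `L` a multiplicity-free set of `n` exponents all
in `½ + ℤ`, then `Q` has the STANDARD Asai sign `HasAsaiSign cK 1` (`L^S(s, Q, As⁻)` has the pole).
Proof: Mok's dichotomy gives a sign `κ` of `P` (`exists_hasAsaiSign`); the pin with `r = ½` at some
`a ∈ χ σ` (`card = n > 0`) forces `κ = 1` for even `n` and `κ = -1` for odd `n`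
(`units_eq_of_half_eq_pin`), i.e. `P.HasAsaiPole s (-1)` in both parities
(`hasAsaiSign_iff_of_even` / `hasAsaiSign_iff_of_odd`); the transfer gives `Q.HasAsaiPole cK (-1)`,
which is `Q.HasAsaiSign cK 1` for the even rank `2n` (`hasAsaiSign_iff_of_even`).
[cite: Mok2014, Thm. 2.5.4 (a)] -/
theorem stub_paneLaw_cond :
    (∀ (F E : Type) [Field F] [NumberField F] [Field E] [NumberField E] [Algebra F E]
      (c : E ≃ₐ[F] E), Module.finrank F E = 2 → c ≠ 1 →
      ∀ (N : ℕ) (hcpt : isCompact_glFiniteIntegralLevel N E) (P : CuspidalAutomorphicRepData N E hcpt),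
      0 < N → P.1.IsConjSelfDualAE c → ∃ κ : ℤˣ, P.1.HasAsaiSign c κ) →
    (∀ (F E : Type) [Field F] [NumberField F] [Field E] [NumberField E] [Algebra F E]
      (c : E ≃ₐ[F] E), Module.finrank F E = 2 → c ≠ 1 →
    ∀ (N : ℕ) (hcpt : isCompact_glFiniteIntegralLevel N E) (P : CuspidalAutomorphicRepData N E hcpt)
      (κ : ℤˣ) (χ : (E →+* ℂ) → Multiset ℂ) (σ : E →+* ℂ) (r : ℝ),
      0 < N → P.1.IsConjSelfDualAE c → P.1.HasAsaiSign c κ → P.1.HasArchParameter χ →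
      NumberField.ComplexEmbedding.IsConj σ c → (χ σ).Nodup →
      (∀ a ∈ χ σ, ∃ m : ℤ, a = (m : ℂ) + (r : ℂ)) →
      ∀ a ∈ χ σ, ∃ m : ℤ, a = (m : ℂ) + ((N : ℂ) - 1) / 2 + (1 - ((κ : ℤ) : ℂ)) / 4) →
    (∀ (F₀ K F' L : Type) [Field F₀] [NumberField F₀] [Field K] [NumberField K]
      [Field F'] [NumberField F'] [Field L] [NumberField L]
      [Algebra F₀ K] [Algebra K L] [Algebra F' L] (cK : K ≃ₐ[F₀] K) (s : L ≃ₐ[F'] L),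
      Module.finrank F₀ K = 2 → Module.finrank K L = 2 → Module.finrank F' L = 2 → cK ≠ 1 → s ≠ 1 →
      (∀ x : K, s (algebraMap K L x) = algebraMap K L (cK x)) →
    ∀ (n : ℕ) (hL : isCompact_glFiniteIntegralLevel n L)
      (hK : isCompact_glFiniteIntegralLevel (2 * n) K)
      (P : CuspidalAutomorphicRepData n L hL) (Q : CuspidalAutomorphicRepData (2 * n) K hK),
      0 < n → IsAutomorphicInductionAlong P.1 Q.1 → P.1.IsConjSelfDualAE s → Q.1.IsConjSelfDualAE cK →
      ∀ ε : ℤˣ, Q.1.HasAsaiPole cK ε ↔ P.1.HasAsaiPole s ε) →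
    ∀ (F₀ K F' L : Type) [Field F₀] [NumberField F₀] [Field K] [NumberField K]
      [Field F'] [NumberField F'] [Field L] [NumberField L]
      [Algebra F₀ K] [Algebra K L] [Algebra F' L] (cK : K ≃ₐ[F₀] K) (s : L ≃ₐ[F'] L),
      Module.finrank F₀ K = 2 → Module.finrank K L = 2 → Module.finrank F' L = 2 → cK ≠ 1 → s ≠ 1 →
      (∀ x : K, s (algebraMap K L x) = algebraMap K L (cK x)) →
    ∀ (n : ℕ) (hL : isCompact_glFiniteIntegralLevel n L)
      (hK : isCompact_glFiniteIntegralLevel (2 * n) K)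
      (P : CuspidalAutomorphicRepData n L hL) (Q : CuspidalAutomorphicRepData (2 * n) K hK)
      (χ : (L →+* ℂ) → Multiset ℂ) (σ : L →+* ℂ),
      0 < n → IsAutomorphicInductionAlong P.1 Q.1 → P.1.IsConjSelfDualAE s → Q.1.IsConjSelfDualAE cK →
      P.1.HasArchParameter χ → NumberField.ComplexEmbedding.IsConj σ s → (χ σ).Nodup →
      Multiset.card (χ σ) = n → (∀ a ∈ χ σ, ∃ m : ℤ, a = (m : ℂ) + 1 / 2) →
      Q.1.HasAsaiSign cK 1 := by
  intro hex hpin htransfer F₀ K F' L _ _ _ _ _ _ _ _ _ _ _ cK s h2K h2L h2' hcK hs hcomm n hL hK P Q χ σ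
    hn hAI hPcsd hQcsd hχ hσ hnodup hcard hhalf
  -- (1) existence of an Asai sign `κ` of `P` (Mok's dichotomy, supplied as `hex`).
  obtain ⟨κ, hκ⟩ := hex F' L s h2' hs n hL P hn hPcsd
  -- (2) the pin with `r = ½`.
  have hhalf' : ∀ a ∈ χ σ, ∃ m : ℤ, a = (m : ℂ) + ((1 / 2 : ℝ) : ℂ) := by
    intro a ha
    obtain ⟨m, hm⟩ := hhalf a ha
    exact ⟨m, by rw [hm]; push_cast; ring⟩
  have hpinned := hpin F' L s h2' hs n hL P κ χ σ (1 / 2 : ℝ) hn hPcsd hκ hχ hσ hnodup hhalf'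
  -- an exponent exists since `card (χ σ) = n > 0`
  obtain ⟨a, ha⟩ : ∃ a, a ∈ χ σ := Multiset.card_pos_iff_exists_mem.mp (hcard ▸ hn)
  obtain ⟨m', hm'⟩ := hhalf a ha
  obtain ⟨m, hm⟩ := hpinned a ha
  have hparity := units_eq_of_half_eq_pin (m := m) (m' := m') (n := n) (κ := κ) (hm' ▸ hm)
  -- (3) in both parities, `P.HasAsaiPole s (-1)`.
  have hP : P.1.HasAsaiPole s (-1) := by
    rcases Nat.even_or_odd n with hev | hodd
    · have h1 : κ = 1 := hparity.1 hev
      subst h1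
      exact (P.1.hasAsaiSign_iff_of_even hev s 1).mp hκ
    · have h1 : κ = -1 := hparity.2 hodd
      subst h1
      exact (P.1.hasAsaiSign_iff_of_odd hodd s (-1)).mp hκ
  -- (4) transfer to `Q` and read the sign in the even rank `2n`.
  have hQ : Q.1.HasAsaiPole cK (-1) :=
    (htransfer F₀ K F' L cK s h2K h2L h2' hcK hs hcomm n hL hK P Q hn hAI hPcsd hQcsd (-1)).mpr hP
  exact (Q.1.hasAsaiSign_iff_of_even (even_two_mul n) cK 1).mpr hQ

end Summit.Langlands.Langlands.Theorems.HostInducedRep.OneTransparentPane
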